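import Literature.Analysis.Distribution.HormanderEstimates
import HarnessLib

/-!
# Transport of Hörmander operators and of the bracket condition along linear equivalences

Analysis/Hypoelliptic support file. `Transport.lean` pushes vector fields forward along
`T : E ≃L[ℝ] V` into an INNER PRODUCT space `V` (the Fourier model space of Kohn's method). The
same elementary calculus is needed for equivalences `F : E ≃L[ℝ] E'` of general normed spaces —
e.g. the conjugation of a Hörmander operator by a linear symmetry of the underlying space (the
momentum flips of a phase space whose norm is not Euclidean). The pushforward is written out as
`fun y => F (X (F.symm y))` (no new definition):

* `fderiv_conj_equiv`, `lieBracket_conj_equiv` — derivative of the pushforward; brackets commute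
  with pushforward;
* `fieldDeriv_comp_equiv`, `fieldDiv_comp_equiv`, `fieldTranspose_comp_equiv`,
  **`hormanderTranspose_comp_equiv`** — `ᵗP (G ∘ F) = (ᵗP^{F} G) ∘ F` for the pushed-forward data;
* `isIteratedLieBracket_conj_equiv`, **`isBracketGenerating_conj_equiv(_elim)`** — the bracket
  condition of Hörmander's Theorem 1.1 is transported along `F`.

## References

* L. Hörmander, Acta Math. 119 (1967), Thm 1.1 (folklore calculus around it).
-/

noncomputable section

open Set Function VectorField
open scoped ContDiff Topology

namespace Literature.Analysis.Hypoelliptic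

open Literature.Analysis.Distribution

variable {E : Type*} [NormedAddCommGroup E] [NormedSpace ℝ E]
variable {E' : Type*} [NormedAddCommGroup E'] [NormedSpace ℝ E']

/-! ### Pushforward along an equivalence of normed spaces -/

/-- Smoothness of the pushforward `F ∘ X ∘ F⁻¹`. [folklore] -/
theorem contDiff_conj_equiv (F : E ≃L[ℝ] E') {X : E → E} (hX : ContDiff ℝ ∞ X) :
    ContDiff ℝ ∞ (fun y => F (X (F.symm y))) :=
  F.contDiff.comp (hX.comp F.symm.contDiff)

/-- The derivative of the pushforward: `D(F X F⁻¹)(F x) w = F (DX(x) (F⁻¹ w))`. [folklore] -/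
theorem fderiv_conj_equiv (F : E ≃L[ℝ] E') {X : E → E} (hX : Differentiable ℝ X) (x : E) (w : E') :
    fderiv ℝ (fun y => F (X (F.symm y))) (F x) w = F (fderiv ℝ X x (F.symm w)) := by
  have h1 : HasFDerivAt (fun y : E' => X (F.symm y))
      ((fderiv ℝ X (F.symm (F x))).comp (F.symm : E' →L[ℝ] E)) (F x) :=
    (hX _).hasFDerivAt.comp (F x) F.symm.hasFDerivAt
  have h2 : HasFDerivAt (fun y => F (X (F.symm y)))
      ((F : E →L[ℝ] E').comp ((fderiv ℝ X (F.symm (F x))).comp (F.symm : E' →L[ℝ] E))) (F x) :=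
    (F : E →L[ℝ] E').hasFDerivAt.comp (F x) h1
  rw [h2.fderiv, F.symm_apply_apply]
  rfl

/-- **Pushforward commutes with Lie brackets.** [folklore] -/
theorem lieBracket_conj_equiv (F : E ≃L[ℝ] E') {X Y : E → E} (hX : Differentiable ℝ X)
    (hY : Differentiable ℝ Y) :
    (fun y => F (lieBracket ℝ X Y (F.symm y))) =
      lieBracket ℝ (fun y => F (X (F.symm y))) (fun y => F (Y (F.symm y))) := by
  ext y
  obtain ⟨x, rfl⟩ : ∃ x, y = F x := ⟨F.symm y, by simp⟩
  rw [lieBracket, lieBracket, fderiv_conj_equiv F hY, fderiv_conj_equiv F hX]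
  simp

/-! ### Transport of Hörmander's first- and second-order operators -/

/-- `X (G ∘ F) = ((F_*X) G) ∘ F`. [folklore] -/
theorem fieldDeriv_comp_equiv (F : E ≃L[ℝ] E') (X : E → E) {G : E' → ℝ} (hG : Differentiable ℝ G)
    (x : E) : fieldDeriv X (fun x => G (F x)) x = fieldDeriv (fun y => F (X (F.symm y))) G (F x) := by
  simp only [fieldDeriv_apply, ContinuousLinearEquiv.symm_apply_apply]
  rw [show (fun x => G (F x)) = G ∘ (F : E → E') from rfl, fderiv_comp x (hG _) F.differentiableAt]
  simp [ContinuousLinearEquiv.fderiv]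

/-- `div X = (div F_*X) ∘ F`. [folklore] -/
theorem fieldDiv_comp_equiv [FiniteDimensional ℝ E] [FiniteDimensional ℝ E'] (F : E ≃L[ℝ] E')
    {X : E → E} (hX : Differentiable ℝ X) (x : E) :
    fieldDiv X x = fieldDiv (fun y => F (X (F.symm y))) (F x) := by
  unfold fieldDiv
  have h : (fderiv ℝ (fun y => F (X (F.symm y))) (F x) : E' →ₗ[ℝ] E') =
      (F.toLinearEquiv : E ≃ₗ[ℝ] E').conj (fderiv ℝ X x : E →ₗ[ℝ] E) := by
    ext w
    simp only [ContinuousLinearMap.coe_coe, LinearEquiv.conj_apply, LinearMap.coe_comp,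
      LinearEquiv.coe_coe, Function.comp_apply]
    rw [fderiv_conj_equiv F hX]
    rfl
  rw [h, LinearMap.trace_conj']

/-- **`ᵗX (G ∘ F) = (ᵗ(F_*X) G) ∘ F`.** [folklore] -/
theorem fieldTranspose_comp_equiv [FiniteDimensional ℝ E] [FiniteDimensional ℝ E'] (F : E ≃L[ℝ] E')
    {X : E → E} (hX : Differentiable ℝ X) {G : E' → ℝ} (hG : Differentiable ℝ G) (x : E) :
    fieldTranspose X (fun x => G (F x)) x = fieldTranspose (fun y => F (X (F.symm y))) G (F x) := by
  unfold fieldTranspose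
  rw [fieldDeriv_comp_equiv F X hG, fieldDiv_comp_equiv F hX]

/-- **`ᵗP (G ∘ F) = (ᵗP^{F} G) ∘ F`** for the pushed-forward data `(F_*X₀, F_*X_j, c ∘ F⁻¹)`:
conjugating a Hörmander operator by a linear symmetry of the space. [folklore] -/
theorem hormanderTranspose_comp_equiv [FiniteDimensional ℝ E] [FiniteDimensional ℝ E']
    {ι : Type*} [Fintype ι] (F : E ≃L[ℝ] E') {X₀ : E → E} {X : ι → E → E}
    (hX₀ : ContDiff ℝ ∞ X₀) (hX : ∀ j, ContDiff ℝ ∞ (X j)) (c : E → ℝ) {G : E' → ℝ}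
    (hG : ContDiff ℝ ∞ G) (x : E) :
    hormanderTranspose X₀ X c (fun x => G (F x)) x =
      hormanderTranspose (fun y => F (X₀ (F.symm y))) (fun j y => F (X j (F.symm y)))
        (fun y => c (F.symm y)) G (F x) := by
  unfold hormanderTranspose
  have hXd : ∀ j, Differentiable ℝ (X j) := fun j => (hX j).differentiable (by simp)
  have hGd : Differentiable ℝ G := hG.differentiable (by simp)
  have h1 : ∀ j, fieldTranspose (X j) (fieldTranspose (X j) fun x => G (F x)) x =
      fieldTranspose (fun y => F (X j (F.symm y))) (fieldTranspose (fun y => F (X j (F.symm y))) G) (F x) := by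
    intro j
    have e : fieldTranspose (X j) (fun x => G (F x)) =
        fun x => fieldTranspose (fun y => F (X j (F.symm y))) G (F x) :=
      funext fun x => fieldTranspose_comp_equiv F (hXd j) hGd x
    rw [e, fieldTranspose_comp_equiv F (hXd j)]
    exact (contDiff_fieldTranspose (contDiff_conj_equiv F (hX j)) hG).differentiable (by simp)
  simp only [h1, fieldTranspose_comp_equiv F (hX₀.differentiable (by simp)) hGd]
  simp

/-! ### Transport of the bracket condition -/

/-- **Pushforward of iterated brackets**: `F_*` maps the iterated brackets of `(Y_i)` to those of
`(F_* Y_i)`. [folklore] -/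
theorem isIteratedLieBracket_conj_equiv {κ : Type*} {Y : κ → E → E} (hY : ∀ i, ContDiff ℝ ∞ (Y i))
    (F : E ≃L[ℝ] E') {Z : E → E} (hZ : IsIteratedLieBracket Y Z) :
    IsIteratedLieBracket (fun i y => F (Y i (F.symm y))) (fun y => F (Z (F.symm y))) := by
  induction hZ with
  | of i => exact IsIteratedLieBracket.of i
  | lieBracket i hV ih =>
    rw [lieBracket_conj_equiv F ((hY i).differentiable (by simp))
      ((hV.contDiff hY).differentiable (by simp))]
    exact IsIteratedLieBracket.lieBracket i ih

/-- **The bracket condition is transported along linear equivalences**: if the iterated brackets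
of `(Y_i)` span at every point of `s`, those of `(F_* Y_i)` span at every point of `F '' s`.
[folklore] -/
theorem isBracketGenerating_conj_equiv {κ : Type*} {Y : κ → E → E} (hY : ∀ i, ContDiff ℝ ∞ (Y i))
    (F : E ≃L[ℝ] E') {s : Set E} (h : IsBracketGenerating Y s) :
    IsBracketGenerating (fun i y => F (Y i (F.symm y))) (F '' s) := by
  rintro _ ⟨x, hx, rfl⟩
  have hsub : ((F : E →ₗ[ℝ] E') : E → E') '' {v : E | ∃ Z, IsIteratedLieBracket Y Z ∧ Z x = v} ⊆
      {v : E' | ∃ Z, IsIteratedLieBracket (fun i y => F (Y i (F.symm y))) Z ∧ Z (F x) = v} := by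
    rintro _ ⟨v, ⟨Z, hZ, rfl⟩, rfl⟩
    exact ⟨fun y => F (Z (F.symm y)), isIteratedLieBracket_conj_equiv hY F hZ, by simp⟩
  have h1 : Submodule.span ℝ (((F : E →ₗ[ℝ] E') : E → E') ''
      {v : E | ∃ Z, IsIteratedLieBracket Y Z ∧ Z x = v}) = ⊤ := by
    rw [Submodule.span_image, h x hx, Submodule.map_top, LinearMap.range_eq_top]
    exact F.surjective
  rw [eq_top_iff, ← h1]
  exact Submodule.span_mono hsub

/-- The same for the `Option`-indexed families `(X₀, X)` of Hörmander's Theorem 1.1 on the whole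
space. [folklore] -/
theorem isBracketGenerating_conj_equiv_elim {ι : Type*} {X₀ : E → E} {X : ι → E → E}
    (hX₀ : ContDiff ℝ ∞ X₀) (hX : ∀ j, ContDiff ℝ ∞ (X j)) (F : E ≃L[ℝ] E')
    (h : IsBracketGenerating (fun o : Option ι => o.elim X₀ X) univ) :
    IsBracketGenerating (fun o : Option ι => o.elim (fun y => F (X₀ (F.symm y)))
      (fun j y => F (X j (F.symm y)))) univ := by
  have hY : ∀ o : Option ι, ContDiff ℝ ∞ ((fun o : Option ι => o.elim X₀ X) o) := by
    rintro (_ | j)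
    · exact hX₀
    · exact hX j
  have h2 := isBracketGenerating_conj_equiv hY F h
  rw [Set.image_univ_of_surjective F.surjective] at h2
  have e : (fun (o : Option ι) y => F ((fun o : Option ι => o.elim X₀ X) o (F.symm y))) =
      fun o : Option ι => o.elim (fun y => F (X₀ (F.symm y))) (fun j y => F (X j (F.symm y))) := by
    funext o; cases o <;> rfl
  rwa [e] at h2

end Literature.Analysis.Hypoelliptic
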